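import Literature.Topology.FourManifolds.KhAntiBigonStates
import Literature.Topology.FourManifolds.KhBigonHomotopy
import HarnessLib

/-!
# Invariance of Khovanov homology under the anti-parallel second Reidemeister move (the bigon)

Sibling file of `KhBigonHomotopy.lean`, assembling `KhAntiBigon`, `KhAntiBigonD`,
`KhAntiBigonStates` (the bigon `G.antiBigon m ε` of `RMove.omega2c` in normal position and its
adapted basis `A ⊕ P ⊕ Q ⊕ U ⊕ C(D)`) with the Gaussian elimination of `KhGaussElim` exactly as
`KhBigonHomotopy` does for the co-oriented bigon (Khovanov (2000), Thm. 1, §5.3; Bar-Natan (2002),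
§4.3; the move `Ω2c/Ω2d` of Polyak (2010)):

* `antiBigonMHtpy` — **the complex of the anti-parallel bigon retracts by deformation onto the
  complex of `G`**: in the adapted basis, rescaled by the Koszul signs, the block `A → P` (split
  off the small circle labelled `X`) and then the block `Q → U` (merge the small circle labelled
  `1`) are identity matrices and are cancelled by two Gaussian eliminations (`KhElim.elim`); what
  is left is the unoriented resolution `C(D_{10}) = C(D)` with its own differential
  (`incidence_antiD`). This needs `d² = 0` for the bigon, which holds as soon as every edge of its
  cube is a merge or a split;
* `nonempty_iso_khovanovHomology_antiBigon` — **`Kh^{i,j}(G) ≅ Kh^{i,j}(G.antiBigon m ε)`**, and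
  `nonempty_iso_frobeniusHomology_antiBigon` — the same over the universal Frobenius system,
  every `(R, h, t)`, under that merge-or-split hypothesis; `…_of_hasGaussDiagram` — the same for
  a bigon realised by a knot.

No named fact is introduced.

## References

* M. Khovanov, *A categorification of the Jones polynomial*, Duke Math. J. 101 (2000) 359–426,
  §5.3, Thm. 1. [cite: Khovanov2000, §5.3]
* D. Bar-Natan, *On Khovanov's categorification of the Jones polynomial*, Algebr. Geom. Topol. 2
  (2002) 337–370, §4.3. [cite: BarNatan2002, §4]
* D. Bar-Natan, *Fast Khovanov homology computations*, J. Knot Theory Ramifications 16 (2007)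
  243–255, Lemma 4.2. [cite: BarNatan2007, Lemma 4.2]
* M. Polyak, *Minimal generating sets of Reidemeister moves*, Quantum Topol. 1 (2010), Thm. 1.2.
  [cite: Polyak2010, Thm 1.2]
-/

open Function Finset

noncomputable section

namespace Literature.Topology.FourManifolds

namespace GaussDiagram

open KhElim

variable (G : GaussDiagram) (m : Fin (2 * G.n + 1)) (ε : ℤˣ)

/-- The index type of the adapted basis `A ⊕ P ⊕ Q ⊕ U ⊕ C(D)` of the antiBigon. [folklore] -/
abbrev AntiBigonIdx : Type := G.XA' m ε ⊕ (G.XA' m ε ⊕ (G.XA' m ε ⊕ (G.XA' m ε ⊕ G.EnhancedState)))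

section Ring

variable {R : Type} [CommRing R] (hR tR : R)

/-- The incidence matrix of the antiBigon in the adapted basis. [folklore] -/
def antiBigonJ (a b : G.AntiBigonIdx m ε) : R :=
  (G.antiBigon m ε).incidence R hR tR (G.embSum' m ε a) (G.embSum' m ε b)

/-- **The Koszul signs used to rescale the adapted basis**: on `A` the sign of the edge at `f`,
on `Q` the sign of the edge at `g`, `1` elsewhere. [folklore] -/
def antiBigonU : G.AntiBigonIdx m ε → R :=
  Sum.elim (fun x ↦ (edgeSign (G.stA' m ε (G.oldOf' m ε x.1.state)) (G.fC' m ε) : R))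
    (Sum.elim (fun _ ↦ 1)
      (Sum.elim (fun x ↦ (edgeSign (G.stO' m ε (G.oldOf' m ε x.1.state)) (G.gC' m ε) : R))
        (fun _ ↦ 1)))

/-- The rescaling signs are self-inverse. [folklore] -/
theorem antiBigonU_mul_self (a : G.AntiBigonIdx m ε) : G.antiBigonU m ε (R := R) a * G.antiBigonU m ε a = 1 := by
  rcases a with x | x | x | r
  · exact Transfer.edgeSign_mul_self _ _
  · exact one_mul 1
  · exact Transfer.edgeSign_mul_self _ _
  · exact one_mul 1

/-- **The rescaled incidence matrix of the antiBigon in the adapted basis.** [folklore] -/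
def antiBigonJ' (a b : G.AntiBigonIdx m ε) : R := G.antiBigonU m ε a * G.antiBigonJ m ε hR tR a b * G.antiBigonU m ε b

variable (hms : ∀ (τ : (G.antiBigon m ε).State) (k : Fin (G.antiBigon m ε).n), τ k = false →
  (G.antiBigon m ε).IsMergeAt τ k ∨ (G.antiBigon m ε).IsSplitAt τ k)

include hms in
/-- `d² = 0` for the antiBigon in the adapted basis (from merge-or-split). [folklore] -/
theorem sum_antiBigonJ_mul (a z : G.AntiBigonIdx m ε) :
    ∑ y, G.antiBigonJ m ε hR tR a y * G.antiBigonJ m ε hR tR y z = 0 := by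
  unfold antiBigonJ
  rw [show (∑ y, (G.antiBigon m ε).incidence R hR tR (G.embSum' m ε a) (G.embSum' m ε y) *
      (G.antiBigon m ε).incidence R hR tR (G.embSum' m ε y) (G.embSum' m ε z)) =
      ∑ y, (G.antiBigon m ε).incidence R hR tR (G.embSum' m ε a) (G.antiESEquiv m ε y) *
      (G.antiBigon m ε).incidence R hR tR (G.antiESEquiv m ε y) (G.embSum' m ε z) from rfl,
    (G.antiESEquiv m ε).sum_comp (fun t ↦ (G.antiBigon m ε).incidence R hR tR (G.embSum' m ε a) t *
      (G.antiBigon m ε).incidence R hR tR t (G.embSum' m ε z))]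
  exact sum_incidence_mul_incidence_eq_zero hms hR tR _ _

include hms in
/-- `d² = 0` for the rescaled matrix. [folklore] -/
theorem sum_antiBigonJ'_mul (a z : G.AntiBigonIdx m ε) :
    ∑ y, G.antiBigonJ' m ε hR tR a y * G.antiBigonJ' m ε hR tR y z = 0 := by
  unfold antiBigonJ'
  have key : ∀ y, G.antiBigonU m ε a * G.antiBigonJ m ε hR tR a y * G.antiBigonU m ε y *
      (G.antiBigonU m ε y * G.antiBigonJ m ε hR tR y z * G.antiBigonU m ε z) =
      G.antiBigonU m ε a * G.antiBigonU m ε z * (G.antiBigonJ m ε hR tR a y * G.antiBigonJ m ε hR tR y z) := by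
    intro y
    have := G.antiBigonU_mul_self m ε (R := R) y
    linear_combination (G.antiBigonU m ε a * G.antiBigonU m ε z * G.antiBigonJ m ε hR tR a y *
      G.antiBigonJ m ε hR tR y z) * this
  simp only [key, ← Finset.mul_sum, G.sum_antiBigonJ_mul m ε hR tR hms, mul_zero]

/-- **The block `A → P` of the rescaled matrix is the identity.** [folklore] -/
theorem antiBigonJ'_AP (x x' : G.XA' m ε) :
    G.antiBigonJ' m ε hR tR (.inl x) (.inr (.inl x')) = if x = x' then 1 else 0 := by
  unfold antiBigonJ' antiBigonJ antiBigonU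
  simp only [Sum.elim_inl, Sum.elim_inr, embSum_inl', embSum_inr_inl', mul_one]
  rw [incidence_embA_embP']
  split_ifs
  · exact Transfer.edgeSign_mul_self _ _
  · exact mul_zero _

/-- The blocks of the rescaled matrix from `Q`, `U`, `C(D)` into `P` vanish. [folklore] -/
theorem antiBigonJ'_C1_P (r : G.XA' m ε ⊕ (G.XA' m ε ⊕ G.EnhancedState)) (x : G.XA' m ε) :
    G.antiBigonJ' m ε hR tR (.inr (.inr r)) (.inr (.inl x)) = 0 := by
  unfold antiBigonJ' antiBigonJ
  rcases r with q | q | s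
  · simp only [embSum_inr_inr_inl', embSum_inr_inl']
    rw [incidence_eq_zero_of_label_sideM_ne' hR tR (embO_state' q false) (embO_state' x true)
      (by rw [embO_label_sideM', embO_label_sideM']; decide), mul_zero, zero_mul]
  · simp only [embSum_inr_inr_inr_inl', embSum_inr_inl']
    rw [incidence_eq_zero_of_state_true_false hR tR (G.gC' m ε)
      (by rw [embU_state']; exact G.stU_gC' m ε _) (by rw [embO_state']; exact G.stO_gC' m ε _),
      mul_zero, zero_mul]
  · simp only [embSum_inr_inr_inr_inr', embSum_inr_inl']
    rw [incidence_eq_zero_of_state_true_false hR tR (G.gC' m ε)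
      (by rw [antiD_state]; exact G.stD_gC' m ε _) (by rw [embO_state']; exact G.stO_gC' m ε _),
      mul_zero, zero_mul]

/-- **The matrix after the first cancellation**: the rescaled matrix restricted to
`Q ⊕ U ⊕ C(D)`. [folklore] -/
def antiBigonJ'' (r r' : G.XA' m ε ⊕ (G.XA' m ε ⊕ G.EnhancedState)) : R :=
  G.antiBigonJ' m ε hR tR (.inr (.inr r)) (.inr (.inr r'))

/-- The reduced matrix of the first cancellation is the restriction (no correction term).
[folklore] -/
theorem redI_antiBigonJ' (r r' : G.XA' m ε ⊕ (G.XA' m ε ⊕ G.EnhancedState)) :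
    redI (G.antiBigonJ' m ε hR tR) r r' = G.antiBigonJ'' m ε hR tR r r' := by
  unfold redI antiBigonJ''
  simp only [antiBigonJ'_C1_P, zero_mul, Finset.sum_const_zero, sub_zero]

include hms in
/-- `d² = 0` after the first cancellation. [folklore] -/
theorem sum_antiBigonJ''_mul (a z : G.XA' m ε ⊕ (G.XA' m ε ⊕ G.EnhancedState)) :
    ∑ y, G.antiBigonJ'' m ε hR tR a y * G.antiBigonJ'' m ε hR tR y z = 0 := by
  have := sum_redI_mul_redI (G.sum_antiBigonJ'_mul m ε hR tR hms) (G.antiBigonJ'_AP m ε hR tR) a z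
  simpa only [redI_antiBigonJ'] using this

/-- **The block `Q → U` of the matrix after the first cancellation is the identity.** [folklore] -/
theorem antiBigonJ''_QU (x x' : G.XA' m ε) :
    G.antiBigonJ'' m ε hR tR (.inl x) (.inr (.inl x')) = if x = x' then 1 else 0 := by
  unfold antiBigonJ'' antiBigonJ' antiBigonJ antiBigonU
  simp only [Sum.elim_inl, Sum.elim_inr, embSum_inr_inr_inl', embSum_inr_inr_inr_inl', mul_one]
  rw [incidence_embQ_embU']
  split_ifs
  · exact Transfer.edgeSign_mul_self _ _
  · exact mul_zero _

/-- The block from `Q` into `C(D)` vanishes. [folklore] -/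
theorem antiBigonJ''_Q_D (x : G.XA' m ε) (s : G.EnhancedState) :
    G.antiBigonJ'' m ε hR tR (.inl x) (.inr (.inr s)) = 0 := by
  unfold antiBigonJ'' antiBigonJ' antiBigonJ
  simp only [embSum_inr_inr_inl', embSum_inr_inr_inr_inr']
  rw [incidence_eq_zero_of_state_true_false hR tR (G.fC' m ε)
    (by rw [embO_state']; exact G.stO_fC' m ε _) (by rw [antiD_state]; exact G.stD_fC' m ε _),
    mul_zero, zero_mul]

/-- **The matrix after both cancellations is the incidence matrix of `G`.** [folklore] -/
theorem redI_antiBigonJ'' (s s' : G.EnhancedState) :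
    redI (G.antiBigonJ'' m ε hR tR) s s' = G.incidence R hR tR s s' := by
  unfold redI
  simp only [antiBigonJ''_Q_D, mul_zero, Finset.sum_const_zero, sub_zero]
  unfold antiBigonJ'' antiBigonJ' antiBigonJ antiBigonU
  simp only [Sum.elim_inr, embSum_inr_inr_inr_inr', one_mul, mul_one]
  exact incidence_antiD m ε hR tR s s'

/-- **The complex of the antiBigon retracts by deformation onto the complex of `G`** (total
homotopy data between the incidence matrices): relabel to the adapted basis, rescale by the
Koszul signs, cancel the identity block `A → P`, then the identity block `Q → U`
(`KhElim.elim`, Bar-Natan (2007), Lemma 4.2), and identify what is left with `C(D)`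
(`redI_antiBigonJ''`). Khovanov (2000), §5.3; Bar-Natan (2002), §4.3. [cite: Khovanov2000, §5.3] -/
def antiBigonMHtpy : MHtpy ((G.antiBigon m ε).incidence R hR tR) (G.incidence R hR tR) :=
  (MHtpy.ofEquiv (G.antiESEquiv m ε) ((G.antiBigon m ε).incidence R hR tR) (G.antiBigonJ m ε hR tR)
      (fun _ _ ↦ rfl)).trans
    ((MHtpy.rescale (G.antiBigonJ m ε hR tR) (G.antiBigonU m ε) (G.antiBigonU_mul_self m ε)).trans
      (((KhElim.elim (G.sum_antiBigonJ'_mul m ε hR tR hms) (G.antiBigonJ'_AP m ε hR tR)).congrRight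
          (G.redI_antiBigonJ' m ε hR tR)).trans
        ((KhElim.elim (G.sum_antiBigonJ''_mul m ε hR tR hms) (G.antiBigonJ''_QU m ε hR tR)).congrRight
          (G.redI_antiBigonJ'' m ε hR tR))))

/-- **Total homotopy data between the Khovanov cochains of `G` and of the antiBigon.**
[cite: Khovanov2000, §5.3] -/
def antiBigonHtpyData : HtpyData R G (G.antiBigon m ε) hR tR := (G.antiBigonMHtpy m ε hR tR hms).toHtpyData

/-! ### Degrees -/

/-- A degree map on the enhanced states of the antiBigon is **admissible** if nonzero incidence
numbers raise it by `(1, 0)`, both over `R` and over `ℤ` at `h = t = 0`. [folklore] -/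
structure AdmissibleDeg' (d : (G.antiBigon m ε).EnhancedState → ℤ × ℤ) : Prop where
  /-- Over `R`. -/
  ringDeg : ∀ a b, (G.antiBigon m ε).incidence R hR tR a b ≠ 0 → d b = d a + (1, 0)
  /-- Over `ℤ` at `h = t = 0`. -/
  intDeg : ∀ a b, (G.antiBigon m ε).incidence ℤ 0 0 a b ≠ 0 → d b = d a + (1, 0)

variable {hR tR}

/-- **The homotopy data of the antiBigon are graded** for every admissible degree map (source
degrees read through `antiD`). [folklore] -/
theorem isGraded_antiBigonMHtpy {d : (G.antiBigon m ε).EnhancedState → ℤ × ℤ}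
    (hd : G.AdmissibleDeg' m ε hR tR d) :
    (G.antiBigonMHtpy m ε hR tR hms).IsGraded d (fun s ↦ d (antiD m ε s)) := by
  unfold antiBigonMHtpy
  refine MHtpy.IsGraded.trans (MHtpy.IsGraded.ofEquiv _ _ _ _ (dT := fun a ↦ d (G.embSum' m ε a))
    (fun _ ↦ rfl)) ?_
  refine MHtpy.IsGraded.trans (MHtpy.IsGraded.rescale _ _ _ _) ?_
  have hI : ∀ a b, G.antiBigonJ' m ε hR tR a b ≠ 0 →
      d (G.embSum' m ε b) = d (G.embSum' m ε a) + (1, 0) := by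
    intro a b hab
    apply hd.ringDeg
    intro h0
    apply hab
    unfold antiBigonJ' antiBigonJ
    rw [h0, mul_zero, zero_mul]
  refine MHtpy.IsGraded.trans (MHtpy.IsGraded.congrRight _ (MHtpy.IsGraded.elim _ _ hI ?_)) ?_
  · intro x
    simp only [embSum_inr_inl', embSum_inl']
    exact hd.intDeg _ _ (incidence_embA_embP_self_ne_zero' x)
  · refine MHtpy.IsGraded.congrRight _ (MHtpy.IsGraded.elim _ _ (fun a b hab ↦ hI _ _ hab) ?_)
    intro x
    simp only [embSum_inr_inr_inl', embSum_inr_inr_inr_inl']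
    exact hd.intDeg _ _ (incidence_embQ_embU_self_ne_zero' x)

variable (hR tR)

/-- The homological degree (alone) is an admissible degree map. [folklore] -/
theorem admissibleDeg_homDegree' :
    G.AdmissibleDeg' m ε hR tR (fun s ↦ ((homDegree s : ℤ), (0 : ℤ))) where
  ringDeg a b h0 := by
    rw [Prod.mk_add_mk, add_zero, homDegree_eq_of_incidence_ne_zero h0]
  intDeg a b h0 := by
    rw [Prod.mk_add_mk, add_zero, homDegree_eq_of_incidence_ne_zero h0]

/-- The bidegree is an admissible degree map at `h = t = 0` over `ℤ`. [folklore] -/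
theorem admissibleDeg_bideg' :
    G.AdmissibleDeg' m ε (0 : ℤ) 0 (fun s ↦ (homDegree s, qDegree s)) where
  ringDeg a b h0 := by
    rw [Prod.mk_add_mk, add_zero, homDegree_eq_of_incidence_ne_zero h0,
      qDegree_eq_of_incidence_ne_zero_holds h0]
  intDeg a b h0 := by
    rw [Prod.mk_add_mk, add_zero, homDegree_eq_of_incidence_ne_zero h0,
      qDegree_eq_of_incidence_ne_zero_holds h0]

/-! ### The isomorphisms -/

include hms in
/-- **Invariance of the homology over the universal Frobenius system under the second
Reidemeister move (antiBigon in normal position)**, for a antiBigon all of whose cube edges are merges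
or splits: `H^i(G; h, t) ≅ H^i(G.antiBigon m ε; h, t)` for every `(R, h, t)` and `i`.
Khovanov (2000), §5.3 (with Khovanov (2006) for general `(h, t)`); Bar-Natan (2002), §4.3.
[cite: Khovanov2000, §5.3] -/
theorem nonempty_iso_frobeniusHomology_antiBigon (i : ℤ) :
    Nonempty (G.frobeniusHomology R hR tR i ≅ (G.antiBigon m ε).frobeniusHomology R hR tR i) := by
  have hg := G.isGraded_antiBigonMHtpy m ε hms (G.admissibleDeg_homDegree' m ε hR tR)
  refine (G.antiBigonHtpyData m ε hR tR hms).nonempty_iso_frobeniusHomology ?_ ?_ ?_ i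
  · intro k w hw s hs
    refine hg.F.apply_eq_zero_fst (i := k) (fun t ht ↦ hw t ?_) ?_
    · simpa [homDegree_antiD] using ht
    · simpa using hs
  · intro k v hv s hs
    refine hg.B.apply_eq_zero_fst (i := k) (fun t ht ↦ hv t (by simpa using ht)) ?_
    simpa [homDegree_antiD] using hs
  · intro k v hv s hs
    refine hg.H.apply_eq_zero_fst (i := k) (fun t ht ↦ hv t (by simpa using ht)) ?_
    simp only [ne_eq]
    intro h
    exact hs (by omega)

include hms in
/-- **Invariance of Khovanov homology under the second Reidemeister move (antiBigon in normal
position)**, for a antiBigon all of whose cube edges are merges or splits: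
`Kh^{i,j}(G) ≅ Kh^{i,j}(G.antiBigon m ε)`. Khovanov (2000), §5.3, Thm. 1; Bar-Natan (2002),
§4.3. [cite: Khovanov2000, §5.3] -/
theorem nonempty_iso_khovanovHomology_antiBigon (i j : ℤ) :
    Nonempty (G.khovanovHomology i j ≅ (G.antiBigon m ε).khovanovHomology i j) := by
  have hg := G.isGraded_antiBigonMHtpy m ε (hR := (0 : ℤ)) (tR := 0) hms (G.admissibleDeg_bideg' m ε)
  refine (G.antiBigonHtpyData m ε (0 : ℤ) 0 hms).nonempty_iso_khovanovHomology ?_ ?_ ?_ i j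
  · intro k l w hw s hs
    refine hg.F.apply_eq_zero (g := (k, l)) (fun t ht ↦ hw t ?_) ?_
    · simpa [homDegree_antiD, qDegree_antiD, Prod.ext_iff] using ht
    · simpa [Prod.ext_iff] using hs
  · intro k l v hv s hs
    refine hg.B.apply_eq_zero (g := (k, l)) (fun t ht ↦ hv t (by simpa [Prod.ext_iff] using ht)) ?_
    simpa [homDegree_antiD, qDegree_antiD, Prod.ext_iff] using hs
  · intro k l v hv s hs
    refine hg.H.apply_eq_zero (g := (k, l)) (fun t ht ↦ hv t (by simpa [Prod.ext_iff] using ht)) ?_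
    simp only [ne_eq, Prod.mk_add_mk, add_zero, Prod.ext_iff, not_and]
    intro h
    exact (hs ⟨by omega, ·⟩)

end Ring

/-- **Invariance of Khovanov homology under the second Reidemeister move, for a antiBigon realised
by a knot**: `Kh^{i,j}(G) ≅ Kh^{i,j}(G.antiBigon m ε)`. The merge-or-split hypothesis is the
proved fact `isMergeAt_or_isSplitAt_of_hasGaussDiagram`. Khovanov (2000), §5.3, Thm. 1.
[cite: Khovanov2000, Thm. 1] -/
theorem nonempty_iso_khovanovHomology_antiBigon_of_hasGaussDiagram
    (hK : ∃ K : Knot, K.HasGaussDiagram (G.antiBigon m ε)) (i j : ℤ) :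
    Nonempty (G.khovanovHomology i j ≅ (G.antiBigon m ε).khovanovHomology i j) :=
  G.nonempty_iso_khovanovHomology_antiBigon m ε
    (fun _ _ hτ ↦ isMergeAt_or_isSplitAt_of_hasGaussDiagram_holds hK hτ) i j

/-- **Invariance of the homology over the universal Frobenius system under the second
Reidemeister move, for a antiBigon realised by a knot.** [cite: Khovanov2000, Thm. 1] -/
theorem nonempty_iso_frobeniusHomology_antiBigon_of_hasGaussDiagram {R : Type} [CommRing R] (hR tR : R)
    (hK : ∃ K : Knot, K.HasGaussDiagram (G.antiBigon m ε)) (i : ℤ) :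
    Nonempty (G.frobeniusHomology R hR tR i ≅ (G.antiBigon m ε).frobeniusHomology R hR tR i) :=
  G.nonempty_iso_frobeniusHomology_antiBigon m ε hR tR
    (fun _ _ hτ ↦ isMergeAt_or_isSplitAt_of_hasGaussDiagram_holds hK hτ) i

end GaussDiagram

end Literature.Topology.FourManifolds
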